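import Literature.MathematicalPhysics.QuantumFieldTheory.Balaban1983to89.B9Eq324DeltaPrimeAZd
import Literature.MathematicalPhysics.QuantumFieldTheory.Balaban1983to89.B9SupplySockB9P3ZdLettersOmega

/-!
# `Balaban1983to89.B9Eq321ProjectorKernelZd` — [Balaban1985BackgroundPropagators] (3.21)–(3.23) p. 394 ON THE `ℤᵈ × 𝔸` CARRIER: THE COMPOSITE `λ ↦ R(U₀)(𝟙_{Ω₀}Δ^η_{U₀}λ)`
# OF dag-n06-w4's CONSTRUCTED PROJECTION `R(U₀)` (onto `𝟙_{Ω₀}Δ^η_{U₀}N_𝔤(Q′(U₀))`) HAS A NON-ZERO HERMITIAN KERNEL VECTOR SUPPORTED IN `Ω₀` whenever `Ω₀`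
# contains a level-`0` constraint site — rank–nullity: every `μ ∈ N_𝔤(Q′(U₀))` vanishes there, so `dim R ≤ dim N_𝔤 < dim {Hermitian λ on Ω₀}`

statement-level skeleton of published theorems with citation tags; proofs where landed; nothing here is a claim about the
Yang–Mills mass gap

`[Balaban1985BackgroundPropagators]` ("B9", CMP **99** (1985) 389–434): (3.21) p. 394 «R = R(U) is an orthogonal projection in the Hilbert space L²(Ω₀, 𝔤) onto the
subspace R = Δ^η_U N(Q′), N(Q′) = {λ : Q′λ = 0}», (3.22) (the minimiser), (3.23) (`Δ^η_U`), (3.18)–(3.19) p. 393 (`Q′_j`, `j = 0` reads the identity: `λ = 0` on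
`Λ₀`), (3.26) p. 395 (the letter `D R D*`).  PDF held: `paper:balaban1985-cmp99-background-propagators` pp. 393–395.

CITATION HEADER ∕ WHY THIS FILE (cell `pub-ymgap`, HUMAN RULING D-0062 ∕ D-0149; width seat `pub-ymgap-dag-n06-w3` (g5), node N06 = [B9]; CLAIM-2 file 2∕3;
count-neutral).  File 1∕3 (`B9Thm311TwistPureGaugeZd`) reduces `Δ_a(U₀)(D_{U₀}λ) = 0` at the crossing-bond twist to `R(U₀)(𝟙_{Ω₀}Δ^η_{U₀}λ) = 0`.  THIS file
supplies such a `λ`, for ANY background `U₀` and any faithful Hermitian `τ` on a finite-dimensional fibre: the real space `V` of Hermitian functions supported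
in the finite `Ω₀ = s` maps by `Ψ : λ ↦ R(U₀)(𝟙_sΔ^η_{U₀}λ)` into `R = span{𝟙_sΔ^η_{U₀}μ : μ ∈ N_𝔤(Q′(U₀))}` (dag-n06-w4 g0's `rangeSub`, the image of
`span N_𝔤` under the linear `Θ : μ ↦ 𝟙_sΔ^η_{U₀}μ`), and `N_𝔤 ⊆ V₀ := {λ ∈ V : λ(y₀) = 0} ⊊ V` for a constraint site `y₀ ∈ s ∩ Λ₀` ((3.19) at `j = 0`), so
`dim range Ψ ≤ dim R ≤ dim span N_𝔤 ≤ dim V₀ < dim V` and `ker Ψ ≠ 0`.  No estimate; linear algebra over landed objects.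

WHAT IS PROVED (kernel, 0 sorry; theorems only).  `covLap_smul_real` (`Δ^η_{U₀}` is ℝ-homogeneous; private `covDerivFwd_smul_real' ∕ covDeriv_smul_real'`),
(`L²(Ω₀, ·)` finite-dimensional: dag-n06-w4 g2's `B9Eq324DeltaPrimeAZd.finiteDimensional_suppSub'`, imported), ★★ `exists_herm_projR_covLap_eq_zero` (`y₀ ∈ s`, `y₀ ∈ Λs 0` ⟹ ∃ Hermitian `λ ≠ 0` supported in `s` with
`projR τ s L m η Λs U₀ (covLap η U₀ λ) = 0`).

HONEST SCOPE.  Finite-dimensional linear algebra (`Submodule.finrank_map_le`, `finrank_lt_finrank_of_lt`, `LinearMap.finrank_range_add_finrank_ker`) over dag-n06-w4's `projE ∕ projR ∕ rangeSub ∕ gaugeNull`; no estimate of [B9]; count-neutral helper of K1⁹ (`--supports stmt-QuantumFields-27364`); N05 ∕ N06 NOT discharged; K1⁹ NOT closed;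
one finite `𝕋⁴` programme at fixed `ε`, Bałaban as printed; R4 closes only the conditional finite-`𝕋⁴` rung `BalabanLadder.UV` — nothing continuum ∕ `ℝ⁴` ∕ OS ∕
mass gap ∕ Clay.  Unit `pub-ymgap-dag-n06-w3` (g5), 2026-08-28.
-/

noncomputable section

open scoped BigOperators
open NormedSpace Complex

namespace Literature.MathematicalPhysics.QuantumFieldTheory.Balaban1983to89.B9Eq321ProjectorKernelZd

open B7Prop1Explicit (e)
open B7Eq78Linearization (conjR QprimeIter_zero)
open B8Ineq132 (covDeriv covDerivFwd)
open B8Eq138LandauZd (covDivB covLap)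
open B9Eq321LandauProjectionZd (suppSub gaugeNull rangeGen rangeSub projE projR indicator_mem_suppSub projE_apply_mem_range)

export B7Prop1Explicit (Site)

variable {d : ℕ}

/-! ## §1  Rank–nullity: a non-zero Hermitian `λ` supported in `Ω₀` with `R(U₀)(𝟙_{Ω₀}Δ^η_{U₀}λ) = 0` -/

section Kernel

variable {𝔸 : Type*} [CStarAlgebra 𝔸]

/-- `D^η_{U₀,κ}` is ℝ-homogeneous in the function. [cite: Balaban1985RegularSpaces, (1.1) p.76 (linearity)] -/
private theorem covDerivFwd_smul_real' (η : ℝ) (U₀ : Site d → Fin d → 𝔸ˣ) (κ : Fin d) (c : ℝ) (f : Site d → 𝔸) (x : Site d) :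
    covDerivFwd η U₀ κ (c • f) x = c • covDerivFwd η U₀ κ f x := by
  simp only [covDerivFwd, Pi.smul_apply, B7Eq78Linearization.conjR_smul_real, ← smul_sub, smul_comm c η⁻¹]

/-- `D^{η*}_{U₀,κ}` is ℝ-homogeneous in the function. [cite: Balaban1985RegularSpaces, (1.1) p.76 (linearity)] -/
private theorem covDeriv_smul_real' (η : ℝ) (U₀ : Site d → Fin d → 𝔸ˣ) (κ : Fin d) (c : ℝ) (f : Site d → 𝔸) (x : Site d) :
    covDeriv η U₀ κ (c • f) x = c • covDeriv η U₀ κ f x := by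
  simp only [covDeriv, Pi.smul_apply, B7Eq78Linearization.conjR_smul_real, ← smul_sub, smul_comm c η⁻¹]

/-- the covariant Laplacian (3.23) is ℝ-homogeneous in its argument. [cite: Balaban1985BackgroundPropagators, (3.23) p.394 (linearity)] -/
theorem covLap_smul_real (η : ℝ) (U₀ : Site d → Fin d → 𝔸ˣ) (c : ℝ) (f : Site d → 𝔸) (x : Site d) :
    covLap η U₀ (c • f) x = c • covLap η U₀ f x := by
  simp only [covLap, covDivB]
  rw [Finset.smul_sum]
  refine Finset.sum_congr rfl fun μ _ => ?_
  have h : (fun z => covDerivFwd η U₀ μ (c • f) z) = c • fun z => covDerivFwd η U₀ μ f z :=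
    funext fun z => by rw [Pi.smul_apply, covDerivFwd_smul_real']
  rw [h, covDeriv_smul_real']

/-- ★★ **`R(U₀)(𝟙_{Ω₀}Δ^η_{U₀}·)` HAS A NON-ZERO HERMITIAN KERNEL VECTOR SUPPORTED IN `Ω₀`** whenever `Ω₀ = s` contains a level-`0` constraint site `y₀ ∈ Λ₀`:
every `μ ∈ N_𝔤(Q′(U₀))` vanishes at `y₀` ((3.21) with (3.19) at `j = 0`), so `dim R = dim 𝟙Δ N_𝔤 ≤ dim N_𝔤 < dim {Hermitian λ on Ω₀}`, and the composite
`λ ↦ R(U₀)(𝟙_{Ω₀}Δ^η_{U₀}λ)` of the latter into `R` has a kernel (rank–nullity).  ANY background `U₀`, any faithful Hermitian `τ` on a finite-dimensional fibre.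
[cite: Balaban1985BackgroundPropagators, (3.21)–(3.22) p.394, (3.19) p.393, (3.23) p.394] -/
theorem exists_herm_projR_covLap_eq_zero [FiniteDimensional ℝ 𝔸] [Nontrivial 𝔸] (τ : 𝔸 →ₗ[ℂ] ℂ)
    (hτs : ∀ a : 𝔸, τ (star a) = starRingEnd ℂ (τ a)) (hτp : ∀ a : 𝔸, a ≠ 0 → 0 < (τ (star a * a)).re)
    (s : Finset (Site d)) (L m : ℕ) (η : ℝ) (Λs : ℕ → Set (Site d)) (U₀ : Site d → Fin d → 𝔸ˣ) {y₀ : Site d} (hy₀ : y₀ ∈ s) (hΛ : y₀ ∈ Λs 0) :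
    ∃ lam : Site d → 𝔸, (∀ x, IsSelfAdjoint (lam x)) ∧ (∀ x, x ∉ s → lam x = 0) ∧ lam ≠ 0 ∧
      projR τ s L m η Λs U₀ (covLap η U₀ lam) = 0 := by
  classical
  haveI := B9Eq324DeltaPrimeAZd.finiteDimensional_suppSub' (𝔸 := 𝔸) s
  -- `V` = Hermitian functions supported in `s`; `V₀` = those vanishing at `y₀`
  let V : Submodule ℝ (Site d → 𝔸) :=
    { carrier := {g | (∀ x, x ∉ s → g x = 0) ∧ ∀ x, IsSelfAdjoint (g x)}
      add_mem' := by
        rintro f g ⟨hf, hf'⟩ ⟨hg, hg'⟩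
        exact ⟨fun x hx => by rw [Pi.add_apply, hf x hx, hg x hx, add_zero], fun x => (hf' x).add (hg' x)⟩
      zero_mem' := ⟨fun _ _ => rfl, fun _ => IsSelfAdjoint.zero _⟩
      smul_mem' := by
        rintro c f ⟨hf, hf'⟩
        refine ⟨fun x hx => by rw [Pi.smul_apply, hf x hx, smul_zero], fun x => ?_⟩
        rw [Pi.smul_apply, IsSelfAdjoint, star_smul, star_trivial, (hf' x).star_eq] }
  let V₀ : Submodule ℝ (Site d → 𝔸) := V ⊓ LinearMap.ker (LinearMap.proj y₀)
  -- `Θ λ = 𝟙_s Δλ` read in `L²(Ω₀, ·)`, `Ψ = R(U₀) ∘ Θ` on `V`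
  let Θ : (Site d → 𝔸) →ₗ[ℝ] suppSub (𝔸 := 𝔸) s :=
    { toFun := fun g => ⟨(↑s : Set (Site d)).indicator (covLap η U₀ g), indicator_mem_suppSub s _⟩
      map_add' := fun f g => by
        apply Subtype.ext
        change (↑s : Set (Site d)).indicator (covLap η U₀ (f + g)) = (↑s : Set (Site d)).indicator (covLap η U₀ f) + (↑s : Set (Site d)).indicator (covLap η U₀ g)
        funext a
        simp only [Pi.add_apply, Set.indicator_apply]
        split_ifs
        · exact B9SupplySockB9P3ZdLettersOmega.covLap_add η U₀ f g a
        · rw [add_zero]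
      map_smul' := fun c f => by
        apply Subtype.ext
        change (↑s : Set (Site d)).indicator (covLap η U₀ (c • f)) = c • (↑s : Set (Site d)).indicator (covLap η U₀ f)
        funext a
        simp only [Pi.smul_apply, Set.indicator_apply]
        split_ifs
        · exact covLap_smul_real η U₀ c f a
        · rw [smul_zero] }
  let Ψ : V →ₗ[ℝ] suppSub (𝔸 := 𝔸) s := (projE τ s L m η Λs U₀) ∘ₗ (Θ ∘ₗ V.subtype)
  -- finiteness of the ambient pieces
  have hVle : V ≤ (suppSub (𝔸 := 𝔸) s).comap (LinearMap.id) := fun g hg => hg.1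
  haveI hVfin : FiniteDimensional ℝ V := by
    have h : V ≤ (suppSub (𝔸 := 𝔸) s) := fun g hg => hg.1
    exact Submodule.finiteDimensional_of_le h
  haveI hV₀fin : FiniteDimensional ℝ V₀ := Submodule.finiteDimensional_of_le (inf_le_left : V₀ ≤ V)
  -- `N = span N_𝔤 ≤ V₀ < V`
  have hNle : Submodule.span ℝ (gaugeNull s L m Λs U₀) ≤ V₀ := by
    rw [Submodule.span_le]
    rintro mu ⟨hsa, hsupp, hQ⟩
    refine Submodule.mem_inf.mpr ⟨⟨hsupp, hsa⟩, ?_⟩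
    rw [LinearMap.mem_ker, LinearMap.proj_apply]
    have h0 := hQ 0 (Nat.zero_le m) y₀ hΛ
    rwa [QprimeIter_zero] at h0
  haveI hNfin : FiniteDimensional ℝ (Submodule.span ℝ (gaugeNull s L m Λs U₀)) := Submodule.finiteDimensional_of_le hNle
  have hlt : V₀ < V := by
    refine lt_of_le_of_ne inf_le_left fun h => ?_
    have hw : (fun x => if x = y₀ then (1 : 𝔸) else 0) ∈ V := by
      refine ⟨fun x hx => ?_, fun x => ?_⟩
      · dsimp only
        rw [if_neg]
        rintro rfl
        exact hx hy₀
      · dsimp only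
        split_ifs
        · exact IsSelfAdjoint.one 𝔸
        · exact IsSelfAdjoint.zero 𝔸
    rw [← h] at hw
    have h0 := (Submodule.mem_inf.mp hw).2
    rw [LinearMap.mem_ker, LinearMap.proj_apply] at h0
    simp at h0
  -- the range of `Ψ` lies in `R = (span N_𝔤).map Θ`
  have hrange : LinearMap.range Ψ ≤ rangeSub s L m η Λs U₀ := by
    rintro _ ⟨v, rfl⟩
    exact projE_apply_mem_range L m η Λs U₀ hτs hτp _
  have hR : rangeSub s L m η Λs U₀ = (Submodule.span ℝ (gaugeNull s L m Λs U₀)).map Θ := by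
    rw [rangeSub, ← Submodule.span_image]
    congr 1
    ext w
    constructor
    · rintro ⟨mu, hmu, hw⟩
      exact ⟨mu, hmu, Subtype.ext hw.symm⟩
    · rintro ⟨mu, hmu, rfl⟩
      exact ⟨mu, hmu, rfl⟩
  -- dimension count
  have h1 : Module.finrank ℝ (LinearMap.range Ψ) ≤ Module.finrank ℝ (rangeSub s L m η Λs U₀) := Submodule.finrank_mono hrange
  have h2 : Module.finrank ℝ (rangeSub s L m η Λs U₀) ≤ Module.finrank ℝ (Submodule.span ℝ (gaugeNull s L m Λs U₀)) := by
    rw [hR]; exact Submodule.finrank_map_le Θ _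
  have h3 : Module.finrank ℝ (Submodule.span ℝ (gaugeNull s L m Λs U₀)) ≤ Module.finrank ℝ V₀ := Submodule.finrank_mono hNle
  have h4 : Module.finrank ℝ V₀ < Module.finrank ℝ V := Submodule.finrank_lt_finrank_of_lt hlt
  have h5 := LinearMap.finrank_range_add_finrank_ker Ψ
  have hker : LinearMap.ker Ψ ≠ ⊥ := by
    intro hbot
    rw [hbot, finrank_bot] at h5
    omega
  obtain ⟨v, hv, hv0⟩ := Submodule.exists_mem_ne_zero_of_ne_bot hker
  refine ⟨(v : Site d → 𝔸), v.2.2, v.2.1, fun h => hv0 (Subtype.ext h), ?_⟩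
  have hΨ : Ψ v = 0 := LinearMap.mem_ker.mp hv
  have hcoe : projR τ s L m η Λs U₀ (covLap η U₀ (v : Site d → 𝔸)) = ((Ψ v : suppSub (𝔸 := 𝔸) s) : Site d → 𝔸) := rfl
  rw [hcoe, hΨ]
  rfl

end Kernel

end Literature.MathematicalPhysics.QuantumFieldTheory.Balaban1983to89.B9Eq321ProjectorKernelZd

end
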